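import Summits.FinalStateConjecture.FinalStateConjecture.Theses.EIHFluxBalance
import Summits.FinalStateConjecture.FinalStateConjecture.Theorems.InertialRecession.Negative.KinematicShadow
import Summits.FinalStateConjecture.FinalStateConjecture.Theorems.InertialRecession.Negative.PaintingRigidityStabiliser
import Summits.FinalStateConjecture.FinalStateConjecture.Theorems.EIHFluxBalanceInertialRecessionNoHoles
import HarnessLib

/-!
# Line `momentum-variation-is-paid-in-energy` for crux `InertialRecession` (stmt-FinalStateConjecture-10166)

Crux-plan skeleton, planner-cruxplan-stmt-FinalStateConjecture-10166-momentum-variation-i-0, 2026-08-16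
(round 1, generation 1). Idea card `Cruxes/InertialRecession/Ideas/momentum-variation-is-paid-in-energy.md`
(ideator 1); panel `TRIAGE-r1-{1,2,3}.md` (pass weak / pass / pass→fail-as-costume-unless-merged, with the
unanimous instruction MERGE WITH `square-integrable-kicks` IN THE K1 FORM); line card
`Lines/momentum-variation-is-paid-in-energy.md`. Inputs read: route file `Theses/EIHFluxBalance.lean` rev 5,
`Disproof.lean` (cdisprove, §A–§F), the landed negatives `Theorems/InertialRecession/Negative/{KinematicShadow,
PaintingRigidityStabiliser}.lean` (imported above, so every statement below is checked in their presence),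
the landed positive `Theorems/EIHFluxBalanceInertialRecessionNoHoles.lean` (`N = 0`), `SketchIdeator2.lean`
(`CesaroRecharting`, `CesaroVelocities`, `inertialRecession_of`), the six idea cards, `KerrConvergence.lean`,
`Statement.lean`, `LandauLifshitzPseudotensor.lean`, the barrier catalogue.

## The line (four registered stubs, composition `InertialRecession_of` kernel-checked)

Write the crux as `∀ …, (∃ N, Antecedent 𝒟 N) → Conclusion 𝒟` (Disproof §A, `inertialRecession_iff`); the
binders are opened exactly as in `SketchIdeator2` so that stub 1 is the SHARED transfer of card
`cesaro-velocities-suffice`.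

* STUB 1 `stub_cesaroRecharting` (transfer, shared, L): antecedent + a Cesàro velocity `ξᵢ(t)/t → Vᵢ` for
  every painted centre ⇒ the Statement's decomposition. Verbatim `SketchIdeator2.CesaroRecharting`.
* STUB 2 `stub_energyPaidKicks` (THE ENGINE of this card, merged with `square-integrable-kicks` (i) in the
  K1 form of TRIAGE-r1-3; XL, HARDEST): antecedent + the far-influx budget of stub 3 ⇒ there are
  RE-MODULATED centres `ξ₁ᵢ`, `o(1)`-close to the painted ones, `C²`, whose lab accelerations are bounded by
  `C · Σ_{j ≠ i} ‖ξᵢ − ξⱼ‖⁻²` (the Newtonian / post-Minkowskian level) plus an INTEGRABLE function `ηᵢ`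
  ("the kicks are paid in energy"): `‖ξ̈₁ᵢ(t)‖ ≤ C Σ_{j≠i} s_ij(t)⁻² + ηᵢ(t)`, `ηᵢ ∈ L¹(T, ∞)`.
* STUB 3 `stub_wallInflux` (far budget, M): for `N ≥ 1` the cone weight `1 + d^{7/4}` makes the energy
  exposure of the deviation (all derivative orders `m ≤ 3`) through the receding wall `{|y| = κ′t}`,
  `κ² < κ′ < κ`, integrable in lab time (`o(t^{-7/4})² · t² = o(t^{-3/2})`; TRIAGE F-a/K3). This REPLACES the
  idea card's Klainerman–Nicolò budget (TRIAGE F-e: KN needs `o₄(r^{-3/2})` data, admissible is `o₂(r⁻¹)`).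
* STUB 4 `stub_newtonianBudget` (final motions, one-sided; L–XL): along the painted motion the Newtonian
  work is finite, `∫^∞ ‖ξᵢ − ξⱼ‖⁻² dt < ∞` for every pair — i.e. NO PAIR RECEDES SLOWER THAN `√t` in the
  integrated sense (parabolic `t^{2/3}` is the slowest final motion; Chazy 1922, Marchal–Saari 1976,
  Disproof §E). This is where the card's own corner (prograde-torque out-spirals `D ≲ t^{2/5}`,
  TRIAGE-r1-1 (1), r1-2) is parked as a separately attackable statement instead of being hidden.
* COMPOSITION (proved here, no `sorry` of its own): fix `X, D, 𝒟` and the antecedent's witnesses; by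
  STUB 1 it suffices to give every painted centre a Cesàro velocity; for a hole `i` (so `N ≥ 1`,
  `Fin.pos`) STUB 3 feeds STUB 2; STUB 2 + STUB 4 dominate `‖ξ̈₁ᵢ‖` on `(max T₂ T₄, ∞)` by an integrable
  function, so `ξ̈₁ᵢ ∈ L¹` (`Integrable.mono'`), so `ξ̇₁ᵢ → Vᵢ` (vector freezing lemma
  `tendsto_deriv_of_integrableOn_deriv2`, the `E3` form of Disproof §D `tendsto_of_integrableOn_deriv`), so
  `ξ₁ᵢ(t)/t → Vᵢ` (`tendsto_inv_smul_of_tendsto_deriv`), so `ξᵢ(t)/t → Vᵢ`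
  (`tendsto_inv_smul_of_tendsto_norm_sub`). `N = 0` never reaches the engine (it is STUB 1 with a vacuous
  Cesàro hypothesis = the landed `Theorems.inertialRecession_noHoles`).

## The mechanism inside STUB 2 (why "momentum variation is paid in energy"; for the lead and its workers)

(1) GAUGE AND MODULATION. Work in a late good gauge `Φ₁ = Φ ∘ Θ`, `Θ → id` (generalised wave-map /
harmonic gauge relative to the ansatz near each hole; the conclusion is chart-free, so re-gauging is
legitimate), and RE-MODULATE all ten Poincaré moduli of each hole — mass `M₁ᵢ(t)`, spin and axis, boost
`u₁ᵢ(t)`, centre `ξ₁ᵢ(t)` — by MATCHING the ten Landau–Lifshitz superpotential charges (`P^μ`, `M^{μν}`,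
LL §96) of the fixed co-moving coordinate sphere `Sᵢ(t) = {|y − ξ₁ᵢ(t)| = R₀}` computed for the actual
metric with those of the exactly boosted Kerr–Schild hole (implicit function theorem around the painting;
`|λ₁ − λ| ≲ ‖h‖_{C¹} → 0`, whence the typed closeness `‖ξ₁ᵢ − ξᵢ‖ → 0`; the tree has `P^μ` as
`LandauLifshitz.quasiLocalMomentum`, the six `M^{μν}` charges are a definition request). Boosts are SLAVED
(`u₁ᵢ = ξ̇₁ᵢ`), so the KS-stabiliser loophole (Negative `PaintingRigidityStabiliser`, TRIAGE F1/K2) never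
enters: nothing below constrains the painted `Λᵢ`.
(2) LAW OF MOTION ON A FIXED SPHERE (K1 form). The LL identity `dP_S[f]/dt = −∮_S τ[f]` holds for EVERY
smooth `f` (superpotential antisymmetry; `LLBalanceLaw`, item 10189); fed `Ein[g] = 0` ON the sphere it is
the law of motion `d/dt(γ M₁ᵢ u₁ᵢ + Schott) = F_i^{PM}(λ₁) − ∮ 2Q(∂G₁, ∂h₁) − ∮ Q(∂h₁, ∂h₁) + O(h₁·jet)`.
With all ten charges matched the `ℓ ≤ 1` (zero-mode) content of `h₁` vanishes at linear order and, for
`a = 0`, Schur (rotation-equivariance of `h ↦ ∮τ_lin^{jk} n_k`) kills the `ℓ ≥ 2` part of the LINEAR cross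
term (TRIAGE-r1-3 K1; for `a ≠ 0` the `m = ±1` couplings are total derivatives for plane waves — to be
checked, Mathisson–Papapetrou type). What is left: `‖d/dt(γM₁u₁)ᵢ − Fᵢ^{PM}‖ ≲ Xᵢ(t) + (quasi-static
superposition defects)`, `Xᵢ(t) = ∮_{Sᵢ(t)} Σ_{m≤1} |D^m h₁|²` the ENERGY EXPOSURE; `|Fᵢ^{PM}| ≤ C Σ_j s_ij⁻²`
(1PM Einstein–Infeld–Hoffmann by surface integrals, bounded Lorentz factors; 2PM `M³/s³ ≤ C M²/s²`); the
defects of the superposed ansatz near hole `i` (the missed 1PN cross term `4MᵢMⱼ/(rᵢ s)`, Disproof §F /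
route NUMBERS) have exposure `≲ M²Mⱼ²/(R₀² s²)` — the SAME Newtonian level, hence "modulo the Newtonian
budget"; the Schott/induction term `c′M R₀ u̇` (`c′ = 1/3`, toy j005997) is a stable first-order lag
(kernel `e^{−γ³t/(c′R₀)}`) and mass accretion `Ṁ₁u₁` has finite total variation (matched energy is fed by
the exposure). (3) EXPOSURE BUDGET = ILED WITH LOSS. `∫_T^∞ Xᵢ dt ≤ C(𝔈_T + wall influx + ∫Σ s⁻²)`: an
integrated local energy decay estimate for the charge-free part of `h₁` on the adiabatic (rate-free,
`|λ̇₁| → 0`) receding multi-Kerr background inside the cone, allowed to LOSE derivatives at trapping (paid by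
the `C³` hypothesis: `𝔈_T → 0` is a `C³`-sup quantity times `∫(1+d^{7/4})^{-2}d²dd < ∞`) and to be
non-coercive for the Killing energy (superradiance: frequency-localised / `T̂`-type currents,
`Barriers…adaptedField_timelike`), with boundary influx through the wall supplied by STUB 3 and outflux into
the holes signed. In print: scalar ILED on the full sub-extremal range (DRSR 2016, vendored as
`drsr_wave_integrated_decay_kerr`), Teukolsky (Shlapentokh-Rothman–Teixeira da Costa 2020/23), linearised
gravity / linear stability of Kerr in the full range (Andersson–Häfner–Whiting; Häfner–Hintz–Vasy 2025),
energy–Morawetz on PERTURBATIONS of Kerr (Ma–Szeftel 2024/26); the multi-centre adiabatic gluing is the bet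
(shared with route item 10185 and `ClusterCompleteness`). Output of (2)+(3): the typed conclusion of STUB 2.

WHY THE EXPOSURE IS NOT IN THE TYPES (planner's typing analysis, NOTES.md): any exposure functional written
in the GIVEN lab chart `Φ` with the GIVEN painting is non-integrable for reasons foreign to the physics —
(a) gauge noise of `Φ` (`h = 𝓛_ζ G`, `ζ = ε(t)χ`, `ε → 0` at no rate is allowed by the antecedent and has
`∫ε² = ∞`), (b) the superposition defects above, (c) the monopole mass lag `δMᵢ(t)/r` (`∫δM² dt` may
diverge: wall luminosity `o(t^{-3/2})` only gives `δM = o(t^{-1/2})`). So gauge, modulation and masses MUST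
be the prover's choice (`∃`), and then the only robust typed interface is the L¹ law itself; the exposure
is the proof, recorded here and in the line card. RESHAPE SEAM for the lead: once
`LandauLifshitz.angularMomentumCharge` (definition request) lands, STUB 2 splits into 2a (charge-matched
re-modulation + law of motion with explicit `Xᵢ` in a wave gauge) and 2b (ILED budget for charge-free,
wave-gauged `h₁`), glued by `Xᵢ`.

## Disproof used (`Cruxes/InertialRecession/Disproof.lean`, landed parts imported above)

* §A `inertialRecession_iff`: the binders are opened the same way (stubs quantify `∀ N M a rin Λ ξ γ κ τ₀ U Φ O,
  block → …`). §B (`N = 0` needs the `τ₀`-shift and push-up): now the landed theorem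
  `Theorems.inertialRecession_noHoles`; in this skeleton `N = 0` is discharged inside STUB 1 and the engine
  is only ever invoked with a hole in hand (`Fin.pos i`).
* §C `inertialRecession_false_without_fieldEquations` (= Negative `KinematicShadow`): HONOURED — the line
  uses H = the field equations at STUB 2 (flux balance `Ein[g] = 0` on the spheres, ILED for the linearised
  Einstein equations) and at STUB 4 (law of motion ⇒ final motions). The kinematic witness `centre (1/4)`
  (velocity `cos(log(1+t²)/2)/4`, acceleration `O(1/t)` non-integrable, `N = 1`) violates exactly the
  conclusion of STUB 2 with the empty sum: STUB 2 is where the kinematic shadow is left behind.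
* §D `quadraticRemainder_not_integrable` (no buffer exponent `b ≤ 1` closes pointwise bookkeeping) is
  EVADED structurally: there is no buffer radius `r_b = D^b` — spheres have FIXED radius `R₀`, the quadratic
  term is bounded in TIME-INTEGRATED form (ILED), and the missing rate is replaced by two budgets (energy:
  STUBS 2–3; Newtonian work: STUB 4). `tendsto_of_integrableOn_deriv` (the freezing mechanism) is re-proved
  here for `E3`-valued momenta (`tendsto_deriv_of_integrableOn_deriv2`). `linearRemainder_integrable` /
  `weight_window` (the `7/4 > 3/2` arithmetic) is spent ONLY in STUB 3, at the wall.
* §E regimes: `N = 1` "no self-acceleration is a flux law" = STUB 2 with `Σ_∅ = 0`; parabolic clusters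
  `t^{2/3}` are STUB 4's marginal-but-integrable case (`t^{-4/3}`); the slowly unbinding rotating pair of §E
  (`s ~ t^q`, `q < 1/2`) is exactly what STUB 4 asserts does not occur — its cheapest falsifier.
* §F: separation enters only through `‖ξᵢ − ξⱼ‖ → ∞` (used by STUB 1's disjointness and STUB 2's constants).
* Negative `PaintingRigidityStabiliser` (twist `Λᵢ ↦ Λᵢ·R_z(t)`): no statement below mentions the painted
  `Λᵢ` or any `‖deriv Λ‖`; Cesàro velocities, centres and separations are twist-invariant. Checked by import.
* `ledger negatives --problem FinalStateConjecture`: 0 refuted statements (2026-08-16).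
-/

set_option linter.dupNamespace false

noncomputable section

open scoped BigOperators Topology Manifold Classical MeasureTheory Matrix ContDiff
open Filter Set Function TopologicalSpace MeasureTheory Literature.Geometry.Lorentzian

namespace Summit.FinalStateConjecture.FinalStateConjecture.Cruxes.InertialRecession.MomentumVariationIsPaidInEnergy

/-! ### The four registered stubs (statements fully expanded over tree declarations) -/

/-- **STUB 1 — `stub_cesaroRecharting` (TRANSFER; shared verbatim with card `cesaro-velocities-suffice`,
`SketchIdeator2.CesaroRecharting`; size L).** The crux with its `∃`-binders opened and ONE hypothesis
inserted: every painted centre has a Cesàro velocity, `t⁻¹ • ξᵢ(t) → Vᵢ` (automatically `‖Vᵢ‖ ≤ κ² < 1`).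
Then the Statement's `FinalStateDecomposition` exists: hole charts `Ψᵢ := Φ ∘ Aᵢ ∘ Lᵢ⁻¹` with `Aᵢ` the
Fermi/Poincaré map of the ACTUAL (re-modulated, mollified) motion composed with a radial compression into a
tube `3Rᵢ ≤ D_min/4` (TRIAGE-r1-3 sharpening of (r1): injective, inside `O`, error `O(|jet|·Rᵢ)`; the
time-one-flow variant of the card is NOT injective-safe), flat domain = complement of slowly growing balls
around the actual centres (`setOf_lt_excision_subset_flatDomain` is containment-only, `tendsto_excision_div`
needs `ρᵢ = o(t)` only — which is exactly `ξᵢ(t) − cᵢ − Vᵢt = o(t)`), horizon normalisation inherited from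
the lab chart (`rin < r₊`), exhaustion by the Disproof §B bookkeeping (`τ₀`-shift, one push-up —
`subset_chronologicalPast_of_isOpen` is now in the tree) and `adaptedField_timelike`; `N = 0` is the landed
`Theorems.inertialRecession_noHoles`. The modulation rates the charts must absorb tend to `0` MOD THE KS
STABILISER only (Negative `PaintingRigidityStabiliser`): build `Aᵢ` from the 4-velocity `Λᵢe₀`-class / the
re-modulated `u₁ᵢ` of STUB 2 and, for `aᵢ ≠ 0`, the axis. Why it might fail: the a-priori jet bound for
slaving (TRIAGE F-c) — mitigated because the prover may RE-MODULATE before charting (the conclusion does not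
mention `Λ`). Leans on: `FinalStateDecomposition` (all fields), `Spacetime.IsLateChart`, `truncDeviationCk`,
`boostedKerrBilin`, `poincareInv`, `HasExhaustiveCharts`, `certifiedLate/Slab`, `exteriorOf`,
`Theorems.EIHFluxBalanceInertialRecessionRechart/ChartCalculus` (landed chart calculus),
`MultiCentreKerrSchild.norm_multiCentreKerrSchildBilin_sub_minkowski_le`, `Kerr.norm_iteratedFDeriv_ksPert_le`.
A proof of `SketchIdeator2.CesaroRecharting` closes this stub by `exact`. [cite: DafermosLuk2017, Conjecture 1 (b)–(c)] [folklore] -/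
theorem stub_cesaroRecharting :
    open Literature.Geometry.Lorentzian in ∀ (X : Type) [TopologicalSpace X] [ChartedSpace E3 X] [IsManifold (𝓡 3) ((⊤ : ℕ∞) : WithTop ℕ∞) X] [T2Space X] [SecondCountableTopology X] [ConnectedSpace X], ∀ D ∈ admissibleVacuumData X, ∀ 𝒟 : VacuumCauchyDevelopment D, 𝒟.IsMaximal → ∀ (N : ℕ) (M a rin : Fin N → ℝ) (Λ : Fin N → ℝ → lorentzGroup) (ξ : Fin N → ℝ → E3) (γ κ τ₀ : ℝ) (U : Opens E4) (Φ : U → 𝒟.carrier) (O : Set 𝒟.carrier), ((∀ i, Kerr.IsSubextremal (M i) (a i) ∧ Kerr.rMinus (M i) (a i) < rin i ∧ rin i < Kerr.rPlus (M i) (a i)) ∧ (∀ i t, |((Λ i t : E4 ≃L[ℝ] E4) (E4.basisVector 0)) 0| ≤ γ) ∧ (∀ i, ContDiff ℝ ((⊤ : ℕ∞) : WithTop ℕ∞) (ξ i) ∧ ContDiff ℝ ((⊤ : ℕ∞) : WithTop ℕ∞) (fun t ↦ ((Λ i t : E4 ≃L[ℝ] E4) : E4 →L[ℝ] E4))) ∧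 (∀ i j, i ≠ j → Tendsto (fun t ↦ ‖ξ i t - ξ j t‖) atTop atTop) ∧ (0 < κ ∧ κ < 1 ∧ ∀ i, ∀ᶠ t in atTop, ‖ξ i t‖ ≤ κ ^ 2 * t) ∧ ({x : E4 | τ₀ < x 0 ∧ ∀ i, rin i < Kerr.radius (a i) (poincareInv (Λ i (x 0)) (E4.ofTimeSpace (x 0) (ξ i (x 0))) x)} ⊆ (U : Set E4)) ∧ let B : ModelBackground := ⟨U, fun x ↦ Minkowski.bilin + ∑ i, (boostedKerrBilin (Λ i (x 0)) (E4.ofTimeSpace (x 0) (ξ i (x 0))) (M i) (a i) x - Minkowski.bilin), fun x ↦ x 0, E4.spatialNorm⟩; ContMDiff 𝓘(ℝ, E4) (𝓡 4) ((⊤ : ℕ∞) : WithTop ℕ∞) Φ ∧ Topology.IsOpenEmbedding ((B.lateRegion τ₀).restrict Φ) ∧ Φ '' {x : U | τ₀ < x.1 0 ∧ ∀ i, Kerr.rPlus (M i) (a i) < Kerr.radius (a i) (poincareInv (Λ i (x.1 0)) (E4.ofTimeSpace (x.1 0) (ξ i (x.1 0))) x.1)} ⊆ O ∧ Tendsto (fun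 t ↦ 𝒟.toSpacetime.deviationCk B Φ 3 t) atTop (𝓝 0) ∧ Tendsto (fun t : ℝ ↦ ⨆ x ∈ {x : U | x.1 0 = t ∧ E4.spatialNorm x.1 ≤ κ * t}, ⨆ (m : ℕ) (_ : m ≤ 3), ENNReal.ofReal (1 + √(√((⨅ i, ‖E4.spatial x.1 - ξ i t‖) ^ 7))) * ‖iteratedFDeriv ℝ m (𝒟.toSpacetime.deviationExtend B Φ) x.1‖ₑ) atTop (𝓝 0) ∧ O = Summit.FinalStateConjecture.exteriorOf 𝒟.toCauchyDevelopment (Φ '' {x : U | τ₀ < x.1 0 ∧ ∀ i, Kerr.rPlus (M i) (a i) < Kerr.radius (a i) (poincareInv (Λ i (x.1 0)) (E4.ofTimeSpace (x.1 0) (ξ i (x.1 0))) x.1)}) ∧ ∀ t₁ : ℝ, τ₀ < t₁ → O \ Φ '' {x : U | t₁ < x.1 0 ∧ ∀ i, Kerr.rPlus (M i) (a i) < Kerr.radius (a i) (poincareInv (Λ i (x.1 0)) (E4.ofTimeSpace (x.1 0) (ξ i (x.1 0))) x.1)} ⊆ 𝒟.metric.causalPast 𝒟.timeOrientation (Φ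 '' {x : U | x.1 0 = t₁ ∧ ∀ i, Kerr.rPlus (M i) (a i) < Kerr.radius (a i) (poincareInv (Λ i (x.1 0)) (E4.ofTimeSpace (x.1 0) (ξ i (x.1 0))) x.1)})) → (∀ i : Fin N, ∃ V : E3, Tendsto (fun t : ℝ ↦ t⁻¹ • ξ i t) atTop (𝓝 V)) → ∃ (O : Set 𝒟.carrier) (d : FinalStateDecomposition 𝒟.toSpacetime O 2), (∀ i, Kerr.IsSubextremal (d.mass i) (d.spin i)) ∧ O = Summit.FinalStateConjecture.exteriorOf 𝒟.toCauchyDevelopment d.charted ∧ Summit.FinalStateConjecture.HasExhaustiveCharts d := by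
  sorry

/-- **STUB 2 — `stub_energyPaidKicks` (THE ENGINE; this card merged with `square-integrable-kicks` (i) in
the K1 form; size XL; HARDEST).** Under the antecedent and the far-influx budget of STUB 3 (its conclusion,
verbatim, as hypothesis): there are a time `T`, a constant `C`, RE-MODULATED centres `ξ₁ᵢ : ℝ → E3` of class
`C²` with `‖ξ₁ᵢ(t) − ξᵢ(t)‖ → 0`, and functions `ηᵢ ∈ L¹(T, ∞)` such that for `t ≥ T`
`‖ξ̈₁ᵢ(t)‖ ≤ C · Σ_{j ≠ i} ‖ξᵢ(t) − ξⱼ(t)‖⁻² + ηᵢ(t)`: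
the lab acceleration of every hole is the Newtonian/post-Minkowskian level plus INTEGRABLE kicks. (`N = 0`:
vacuous; `N = 1`: the sum is empty and the statement is "an isolated near-Kerr hole has integrable
acceleration", Disproof §E's "no self-acceleration is a flux law"; painted separations are used on the
right because `ξ₁ − ξ → 0` makes them interchangeable with the re-modulated ones.)
MECHANISM (module docstring §(1)–(3)): full LL Poincaré-charge matching on fixed co-moving spheres
`S(ξ₁ᵢ(t), R₀)` in a late wave-type gauge `Φ ∘ Θ`; `dP_S/dt = −∮τ` with `Ein = 0` on the sphere; linear
cross term killed by the charges (`ℓ ≤ 1`) and Schur (`ℓ ≥ 2`, `a = 0`; `m = ±1` check for `a ≠ 0`);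
quadratic term `≤ C ·` exposure `Xᵢ = ∮ Σ_{m≤1}|D^m h₁|²`; `∫Xᵢ dt ≤ C(𝔈_T + wall influx + ∫Σs⁻²)` by ILED
WITH LOSS on the adiabatic receding multi-Kerr background (loss paid by `C³`; superradiance met by
frequency-localised / `T̂` currents; inter-hole trapping unstable); superposition defects and PM forces
give the `C Σ s⁻²` level; Schott lag `c′MR₀u̇` (`c′ = 1/3`, j005997) is a stable first-order filter; mass
accretion has finite total variation. WHY PLAUSIBLY TRUE: a hole's 4-momentum changes only by (i)
conservative PM forces `≤ CΣs⁻²` and (ii) radiation/field momentum crossing a fixed sphere, whose total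
variation is bounded by the energy crossing it (`|dP| ≤ dE`, dominant-energy structure of `t_LL` for
radiation), and the energy supply after time `T` is finite: state `→ 0`, wall influx integrable (STUB 3),
Newtonian work accounted separately. WHY IT MIGHT FAIL: (a) tensorial ILED on a genuinely time-dependent
multi-centre background with only rate-free control of the modulation (adiabatic errors `∫∫|λ̇₁||∂h₁|²`
absorbed by eventual smallness — standard in shape, heavy); (b) the `a ≠ 0` linear `m = ±1` couplings must
be total derivatives; (c) linearised-gravity ILED in the full range `|a| < M` is 2025–26 frontier
(`SlowlyRotatingKerrFrontier`, moved: HHV 2025, Hintz 2026). Exposure is not typed because in the given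
chart/painting it is polluted by gauge noise, superposition defects and mass lag (module docstring);
reshape seam: split along `Xᵢ` once `LandauLifshitz.angularMomentumCharge` lands. Leans on:
`LandauLifshitz.{hField, superpotential, quasiLocalMomentum, momentumFlux, pseudotensor, emComplex}`, route
supports `LLBalanceLaw` (10189, typed) / `EIHFluxEvaluation` (10188, informal), `Spacetime.deviationExtend`,
`boostedKerrBilin`, `KerrIntegratedDecay.drsr_wave_integrated_decay_kerr(_of_DRSR)`, `KerrLocalEnergyDecay`,
`KerrTrappingMultipliers`, `KerrRedShiftBulk`, `KerrFarMorawetzCoercivity`, `AdiabaticKerrSchildBackground`,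
`AdiabaticTracking`, `Barriers.FinalStateConjecture.adaptedField_timelike`, `Barriers…KerrLinearHair`
(zero modes), `VacuumCauchyDevelopment.isRicciFlat`, `MetricCoord.ricAt` / `ChartMetricCoord` (vacuum in
coordinates). [cite: LandauLifshitz1975, §96] [cite: doi:10.1103/PhysRevD.31.1815]
[cite: DafermosRodnianskiShlapentokhrothman2014, Thm. 3.2] [cite: ShlapentokhrothmanCosta2020]
[cite: HafnerHintzVasy2025, Thm. 1.1] [cite: MaSzeftel2024, Thm. 1.4] [cite: arXiv:0806.3293]
[cite: arXiv:0807.0214] [cite: Jerrard1999] [cite: arXiv:1803.08345] -/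
theorem stub_energyPaidKicks :
    open Literature.Geometry.Lorentzian in ∀ (X : Type) [TopologicalSpace X] [ChartedSpace E3 X] [IsManifold (𝓡 3) ((⊤ : ℕ∞) : WithTop ℕ∞) X] [T2Space X] [SecondCountableTopology X] [ConnectedSpace X], ∀ D ∈ admissibleVacuumData X, ∀ 𝒟 : VacuumCauchyDevelopment D, 𝒟.IsMaximal → ∀ (N : ℕ) (M a rin : Fin N → ℝ) (Λ : Fin N → ℝ → lorentzGroup) (ξ : Fin N → ℝ → E3) (γ κ τ₀ : ℝ) (U : Opens E4) (Φ : U → 𝒟.carrier) (O : Set 𝒟.carrier), ((∀ i, Kerr.IsSubextremal (M i) (a i) ∧ Kerr.rMinus (M i) (a i) < rin i ∧ rin i < Kerr.rPlus (M i) (a i)) ∧ (∀ i t, |((Λ i t : E4 ≃L[ℝ] E4) (E4.basisVector 0)) 0| ≤ γ) ∧ (∀ i, ContDiff ℝ ((⊤ : ℕ∞) : WithTop ℕ∞) (ξ i) ∧ ContDiff ℝ ((⊤ : ℕ∞) : WithTop ℕ∞) (fun t ↦ ((Λ i t : E4 ≃L[ℝ] E4) : E4 →L[ℝ] E4))) ∧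 (∀ i j, i ≠ j → Tendsto (fun t ↦ ‖ξ i t - ξ j t‖) atTop atTop) ∧ (0 < κ ∧ κ < 1 ∧ ∀ i, ∀ᶠ t in atTop, ‖ξ i t‖ ≤ κ ^ 2 * t) ∧ ({x : E4 | τ₀ < x 0 ∧ ∀ i, rin i < Kerr.radius (a i) (poincareInv (Λ i (x 0)) (E4.ofTimeSpace (x 0) (ξ i (x 0))) x)} ⊆ (U : Set E4)) ∧ let B : ModelBackground := ⟨U, fun x ↦ Minkowski.bilin + ∑ i, (boostedKerrBilin (Λ i (x 0)) (E4.ofTimeSpace (x 0) (ξ i (x 0))) (M i) (a i) x - Minkowski.bilin), fun x ↦ x 0, E4.spatialNorm⟩; ContMDiff 𝓘(ℝ, E4) (𝓡 4) ((⊤ : ℕ∞) : WithTop ℕ∞) Φ ∧ Topology.IsOpenEmbedding ((B.lateRegion τ₀).restrict Φ) ∧ Φ '' {x : U | τ₀ < x.1 0 ∧ ∀ i, Kerr.rPlus (M i) (a i) < Kerr.radius (a i) (poincareInv (Λ i (x.1 0)) (E4.ofTimeSpace (x.1 0) (ξ i (x.1 0))) x.1)} ⊆ O ∧ Tendsto (fun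 t ↦ 𝒟.toSpacetime.deviationCk B Φ 3 t) atTop (𝓝 0) ∧ Tendsto (fun t : ℝ ↦ ⨆ x ∈ {x : U | x.1 0 = t ∧ E4.spatialNorm x.1 ≤ κ * t}, ⨆ (m : ℕ) (_ : m ≤ 3), ENNReal.ofReal (1 + √(√((⨅ i, ‖E4.spatial x.1 - ξ i t‖) ^ 7))) * ‖iteratedFDeriv ℝ m (𝒟.toSpacetime.deviationExtend B Φ) x.1‖ₑ) atTop (𝓝 0) ∧ O = Summit.FinalStateConjecture.exteriorOf 𝒟.toCauchyDevelopment (Φ '' {x : U | τ₀ < x.1 0 ∧ ∀ i, Kerr.rPlus (M i) (a i) < Kerr.radius (a i) (poincareInv (Λ i (x.1 0)) (E4.ofTimeSpace (x.1 0) (ξ i (x.1 0))) x.1)}) ∧ ∀ t₁ : ℝ, τ₀ < t₁ → O \ Φ '' {x : U | t₁ < x.1 0 ∧ ∀ i, Kerr.rPlus (M i) (a i) < Kerr.radius (a i) (poincareInv (Λ i (x.1 0)) (E4.ofTimeSpace (x.1 0) (ξ i (x.1 0))) x.1)} ⊆ 𝒟.metric.causalPast 𝒟.timeOrientation (Φ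 '' {x : U | x.1 0 = t₁ ∧ ∀ i, Kerr.rPlus (M i) (a i) < Kerr.radius (a i) (poincareInv (Λ i (x.1 0)) (E4.ofTimeSpace (x.1 0) (ξ i (x.1 0))) x.1)})) → (∀ κ' : ℝ, κ ^ 2 < κ' → κ' < κ → ∃ T : ℝ, IntegrableOn (fun t : ℝ ↦ ∫ y in Metric.sphere (0 : E3) (κ' * t), ∑ m ∈ Finset.range 4, ‖iteratedFDeriv ℝ m (𝒟.toSpacetime.deviationExtend (⟨U, fun x ↦ Minkowski.bilin + ∑ i, (boostedKerrBilin (Λ i (x 0)) (E4.ofTimeSpace (x 0) (ξ i (x 0))) (M i) (a i) x - Minkowski.bilin), fun x ↦ x 0, E4.spatialNorm⟩ : ModelBackground) Φ) (E4.ofTimeSpace t y)‖ ^ 2 ∂(μHE[2] : Measure E3)) (Set.Ioi T)) → ∃ (T C : ℝ) (ξ₁ : Fin N → ℝ → E3) (η : Fin N → ℝ → ℝ), (∀ i, ContDiff ℝ 2 (ξ₁ i)) ∧ (∀ i, Tendsto (fun t ↦ ‖ξ₁ i t - ξ i t‖) atTop (𝓝 0)) ∧ (∀ i, IntegrableOn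 (η i) (Set.Ioi T)) ∧ ∀ i t, T ≤ t → ‖deriv^[2] (ξ₁ i) t‖ ≤ C * (∑ j ∈ Finset.univ.erase i, (‖ξ i t - ξ j t‖ ^ 2)⁻¹) + η i t := by
  sorry

/-- **STUB 3 — `stub_wallInflux` (FAR-INFLUX BUDGET from the cone weight; TRIAGE F-a / K3; size M).** For
`N ≥ 1` and every wall speed `κ′` with `κ² < κ′ < κ` there is `T` such that the energy exposure of the
deviation `h = Φ^*g − G(λ(t))` through the receding coordinate wall `{x⁰ = t, |y| = κ′t}` — all derivative
orders `m ≤ 3`, squared, integrated against the surface measure `μHE[2]` — is integrable on `(T, ∞)`.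
PROOF SKETCH: eventually `‖ξᵢ(t)‖ ≤ κ²t` for all `i` (cone clause), so every wall point is at distance
`d ≥ (κ′ − κ²)t` from every centre and inside `{|y| ≤ κt}`; wall points lie in `U` for large `t`
(`U ⊇ {τ₀ < x⁰, rᵢ > rinᵢ}` and the rest-frame radii there are `≳ t/γ`), so `deviationExtend` is the honest
smooth deviation; the weighted clause gives `(1 + d^{7/4})‖D^m h‖ ≤ δ(t) → 0` for `m ≤ 3` on the solid
cone, hence the integrand is `≤ 4 · 4π(κ′t)² · δ(t)² ((κ′−κ²)t)^{-7/2} = O(δ² t^{-3/2}) ∈ L¹`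
(Disproof `weight_window`: this is the one place where `7/4 > 3/2` is spent); measurability in `t` by
rescaling the sphere to the unit sphere (`μHE[2]` scales by `r²`) and continuity of the integrand for
`t ≥ T`. For `N = 0` the statement would be FALSE as the antecedent is typed (`⨅ i : Fin 0 = sInf ∅ = 0`
makes the weight `≡ 1`, i.e. unweighted), hence the hypothesis `0 < N`; the composition only calls it with
a hole in hand. Replaces the idea card's Klainerman–Nicolò budget (F-e). Leans on: `Spacetime.deviationExtend`,
`supCkENorm`/`iSup` bookkeeping (`enorm_iteratedFDeriv_le_supCkENorm` pattern), `E4.ofTimeSpace`,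
`E4.spatialNorm_ofTimeSpace`, `MeasureTheory.Measure.hausdorffMeasure` scaling, `Real.sInf_empty` (for the
remark). [cite: arXiv08110354, §2.6] [folklore] -/
theorem stub_wallInflux :
    open Literature.Geometry.Lorentzian in ∀ (X : Type) [TopologicalSpace X] [ChartedSpace E3 X] [IsManifold (𝓡 3) ((⊤ : ℕ∞) : WithTop ℕ∞) X] [T2Space X] [SecondCountableTopology X] [ConnectedSpace X], ∀ D ∈ admissibleVacuumData X, ∀ 𝒟 : VacuumCauchyDevelopment D, 𝒟.IsMaximal → ∀ (N : ℕ) (M a rin : Fin N → ℝ) (Λ : Fin N → ℝ → lorentzGroup) (ξ : Fin N → ℝ → E3) (γ κ τ₀ : ℝ) (U : Opens E4) (Φ : U → 𝒟.carrier) (O : Set 𝒟.carrier), ((∀ i, Kerr.IsSubextremal (M i) (a i) ∧ Kerr.rMinus (M i) (a i) < rin i ∧ rin i < Kerr.rPlus (M i) (a i)) ∧ (∀ i t, |((Λ i t : E4 ≃L[ℝ] E4) (E4.basisVector 0)) 0| ≤ γ) ∧ (∀ i, ContDiff ℝ ((⊤ : ℕ∞) : WithTop ℕ∞) (ξ i)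 ∧ ContDiff ℝ ((⊤ : ℕ∞) : WithTop ℕ∞) (fun t ↦ ((Λ i t : E4 ≃L[ℝ] E4) : E4 →L[ℝ] E4))) ∧ (∀ i j, i ≠ j → Tendsto (fun t ↦ ‖ξ i t - ξ j t‖) atTop atTop) ∧ (0 < κ ∧ κ < 1 ∧ ∀ i, ∀ᶠ t in atTop, ‖ξ i t‖ ≤ κ ^ 2 * t) ∧ ({x : E4 | τ₀ < x 0 ∧ ∀ i, rin i < Kerr.radius (a i) (poincareInv (Λ i (x 0)) (E4.ofTimeSpace (x 0) (ξ i (x 0))) x)} ⊆ (U : Set E4)) ∧ let B : ModelBackground := ⟨U, fun x ↦ Minkowski.bilin + ∑ i, (boostedKerrBilin (Λ i (x 0)) (E4.ofTimeSpace (x 0) (ξ i (x 0))) (M i) (a i) x - Minkowski.bilin), fun x ↦ x 0, E4.spatialNorm⟩; ContMDiff 𝓘(ℝ, E4) (𝓡 4) ((⊤ : ℕ∞) : WithTop ℕ∞) Φ ∧ Topology.IsOpenEmbedding ((B.lateRegion τ₀).restrict Φ) ∧ Φ '' {x : U | τ₀ < x.1 0 ∧ ∀ i, Kerr.rPlus (M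 i) (a i) < Kerr.radius (a i) (poincareInv (Λ i (x.1 0)) (E4.ofTimeSpace (x.1 0) (ξ i (x.1 0))) x.1)} ⊆ O ∧ Tendsto (fun t ↦ 𝒟.toSpacetime.deviationCk B Φ 3 t) atTop (𝓝 0) ∧ Tendsto (fun t : ℝ ↦ ⨆ x ∈ {x : U | x.1 0 = t ∧ E4.spatialNorm x.1 ≤ κ * t}, ⨆ (m : ℕ) (_ : m ≤ 3), ENNReal.ofReal (1 + √(√((⨅ i, ‖E4.spatial x.1 - ξ i t‖) ^ 7))) * ‖iteratedFDeriv ℝ m (𝒟.toSpacetime.deviationExtend B Φ) x.1‖ₑ) atTop (𝓝 0) ∧ O = Summit.FinalStateConjecture.exteriorOf 𝒟.toCauchyDevelopment (Φ '' {x : U | τ₀ < x.1 0 ∧ ∀ i, Kerr.rPlus (M i) (a i) < Kerr.radius (a i) (poincareInv (Λ i (x.1 0)) (E4.ofTimeSpace (x.1 0) (ξ i (x.1 0))) x.1)}) ∧ ∀ t₁ : ℝ, τ₀ < t₁ → O \ Φ '' {x : U | t₁ < x.1 0 ∧ ∀ i, Kerr.rPlus (M i) (a i) < Kerr.radius (a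 i) (poincareInv (Λ i (x.1 0)) (E4.ofTimeSpace (x.1 0) (ξ i (x.1 0))) x.1)} ⊆ 𝒟.metric.causalPast 𝒟.timeOrientation (Φ '' {x : U | x.1 0 = t₁ ∧ ∀ i, Kerr.rPlus (M i) (a i) < Kerr.radius (a i) (poincareInv (Λ i (x.1 0)) (E4.ofTimeSpace (x.1 0) (ξ i (x.1 0))) x.1)})) → 0 < N → ∀ κ' : ℝ, κ ^ 2 < κ' → κ' < κ → ∃ T : ℝ, IntegrableOn (fun t : ℝ ↦ ∫ y in Metric.sphere (0 : E3) (κ' * t), ∑ m ∈ Finset.range 4, ‖iteratedFDeriv ℝ m (𝒟.toSpacetime.deviationExtend (⟨U, fun x ↦ Minkowski.bilin + ∑ i, (boostedKerrBilin (Λ i (x 0)) (E4.ofTimeSpace (x 0) (ξ i (x 0))) (M i) (a i) x - Minkowski.bilin), fun x ↦ x 0, E4.spatialNorm⟩ : ModelBackground) Φ) (E4.ofTimeSpace t y)‖ ^ 2 ∂(μHE[2] : Measure E3)) (Set.Ioi T) := by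
  sorry

/-- **STUB 4 — `stub_newtonianBudget` (FINAL MOTIONS, one-sided: no pair recedes slower than `√t`;
size L–XL).** Under the antecedent there is `T` such that for every pair `i ≠ j` the Newtonian work density
`‖ξᵢ(t) − ξⱼ(t)‖⁻²` is integrable on `(T, ∞)`. (Trivial for linearly separating pairs, `t⁻²`; for parabolic
pairs/clusters `s ~ t^{2/3}` it is the marginal-but-integrable `t^{-4/3}` of Disproof §E; it FAILS exactly
for recession like `√t` or slower, which Newtonian final-motion theory excludes when all mutual distances
diverge — Chazy 1922; Marchal–Saari 1976, `rᵢ = Aᵢt + O(t^{2/3})`; Saari 1971 expanding systems — and which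
radiation reaction, being retrograde (Peters 1964; Blanchet LRR §2), cannot create.) WHY A STUB AND NOT
GLUE: with merely `L¹` forcing a persistently PROGRADE torque `f_⊥ = ṡ s^{-3/2}/2 ∈ L¹` sustains out-spirals
`s ~ t^q` for any `q ∈ (0, 2/3)` in the crude forced two-body model (the card's own cheapest falsifier;
TRIAGE-r1-1 (1), r1-2 "deformation-budget corner"), so the budget does NOT follow from STUB 2's sizes — it
needs the conservative STRUCTURE of the leading force (attraction, third law, energy) in each tight
cluster's rest frame plus the smallness of the available pumping: tidal power from a parabolic third body
`∼ a^{1/2}/t²` against binding energy `t^{-q}` is consistent only for `q ≥ 2/3` (Disproof §E), and the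
radiative supply through any sphere of radius `→ ∞` in the cone is `o(t^{-3/2})` (card
`old-light-leaves-the-cone`, `ConeTransportRate`, TRIAGE K4) while a `t^q` out-spiral needs `≳ t^{-1-q/2}`.
Intended proof: STUB 2's law read in cluster rest frames (Newton + small) ⇒ Lagrange–Jacobi / energy on
maximal tight clusters ⇒ `E_∞ = 0 ⇒ s ≳ t^{2/3}` or `E_∞ > 0 ⇒ s ≳ t`; the soft `L¹`-forced N-body lemma
of card `old-light-leaves-the-cone` in its weakest (integrated, one-sided) form — no velocity
classification, no Marchal–Saari rates. WHY IT MIGHT FAIL: an `N ≥ 3` configuration in which a third body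
or incoming radiation keeps torquing a slowly unbinding pair prograde at the rate `t^{-1-q/2}`, `q ≤ 1/2`;
a NEWTONIAN-MODEL counterexample (forced few-body ODE with forcing obeying the two budgets and a sub-`√t`
receding pair) already discredits the stub and is the cheapest kill (kit-sized). Independent of the KS
stabiliser (centres only). Leans on: Mathlib ODE/real analysis only for the model lemma; STUB 2 for the
law. [cite: doi:10.1016/0022-0396(76)90101-7] [cite: doi:10.1090/s0002-9947-1971-0275729-5]
[cite: arXiv:1310.1528, §2] [cite: arXiv:2302.12410] [folklore] -/
theorem stub_newtonianBudget :
    open Literature.Geometry.Lorentzian in ∀ (X : Type) [TopologicalSpace X] [ChartedSpace E3 X] [IsManifold (𝓡 3) ((⊤ : ℕ∞) : WithTop ℕ∞) X] [T2Space X] [SecondCountableTopology X] [ConnectedSpace X], ∀ D ∈ admissibleVacuumData X, ∀ 𝒟 : VacuumCauchyDevelopment D, 𝒟.IsMaximal → ∀ (N : ℕ) (M a rin : Fin N → ℝ) (Λ : Fin N → ℝ → lorentzGroup) (ξ : Fin N → ℝ → E3) (γ κ τ₀ : ℝ) (U : Opens E4) (Φ : U → 𝒟.carrier) (O : Set 𝒟.carrier),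 ((∀ i, Kerr.IsSubextremal (M i) (a i) ∧ Kerr.rMinus (M i) (a i) < rin i ∧ rin i < Kerr.rPlus (M i) (a i)) ∧ (∀ i t, |((Λ i t : E4 ≃L[ℝ] E4) (E4.basisVector 0)) 0| ≤ γ) ∧ (∀ i, ContDiff ℝ ((⊤ : ℕ∞) : WithTop ℕ∞) (ξ i) ∧ ContDiff ℝ ((⊤ : ℕ∞) : WithTop ℕ∞) (fun t ↦ ((Λ i t : E4 ≃L[ℝ] E4) : E4 →L[ℝ] E4))) ∧ (∀ i j, i ≠ j → Tendsto (fun t ↦ ‖ξ i t - ξ j t‖) atTop atTop) ∧ (0 < κ ∧ κ < 1 ∧ ∀ i, ∀ᶠ t in atTop, ‖ξ i t‖ ≤ κ ^ 2 * t) ∧ ({x : E4 | τ₀ < x 0 ∧ ∀ i, rin i < Kerr.radius (a i) (poincareInv (Λ i (x 0)) (E4.ofTimeSpace (x 0) (ξ i (x 0))) x)} ⊆ (U : Set E4)) ∧ let B : ModelBackground := ⟨U, fun x ↦ Minkowski.bilin + ∑ i, (boostedKerrBilin (Λ i (x 0)) (E4.ofTimeSpace (x 0) (ξ i (x 0)))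 (M i) (a i) x - Minkowski.bilin), fun x ↦ x 0, E4.spatialNorm⟩; ContMDiff 𝓘(ℝ, E4) (𝓡 4) ((⊤ : ℕ∞) : WithTop ℕ∞) Φ ∧ Topology.IsOpenEmbedding ((B.lateRegion τ₀).restrict Φ) ∧ Φ '' {x : U | τ₀ < x.1 0 ∧ ∀ i, Kerr.rPlus (M i) (a i) < Kerr.radius (a i) (poincareInv (Λ i (x.1 0)) (E4.ofTimeSpace (x.1 0) (ξ i (x.1 0))) x.1)} ⊆ O ∧ Tendsto (fun t ↦ 𝒟.toSpacetime.deviationCk B Φ 3 t) atTop (𝓝 0) ∧ Tendsto (fun t : ℝ ↦ ⨆ x ∈ {x : U | x.1 0 = t ∧ E4.spatialNorm x.1 ≤ κ * t}, ⨆ (m : ℕ) (_ : m ≤ 3), ENNReal.ofReal (1 + √(√((⨅ i, ‖E4.spatial x.1 - ξ i t‖) ^ 7))) * ‖iteratedFDeriv ℝ m (𝒟.toSpacetime.deviationExtend B Φ) x.1‖ₑ) atTop (𝓝 0) ∧ O = Summit.FinalStateConjecture.exteriorOf 𝒟.toCauchyDevelopment (Φ '' {x : U | τ₀ < x.1 0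 ∧ ∀ i, Kerr.rPlus (M i) (a i) < Kerr.radius (a i) (poincareInv (Λ i (x.1 0)) (E4.ofTimeSpace (x.1 0) (ξ i (x.1 0))) x.1)}) ∧ ∀ t₁ : ℝ, τ₀ < t₁ → O \ Φ '' {x : U | t₁ < x.1 0 ∧ ∀ i, Kerr.rPlus (M i) (a i) < Kerr.radius (a i) (poincareInv (Λ i (x.1 0)) (E4.ofTimeSpace (x.1 0) (ξ i (x.1 0))) x.1)} ⊆ 𝒟.metric.causalPast 𝒟.timeOrientation (Φ '' {x : U | x.1 0 = t₁ ∧ ∀ i, Kerr.rPlus (M i) (a i) < Kerr.radius (a i) (poincareInv (Λ i (x.1 0)) (E4.ofTimeSpace (x.1 0) (ξ i (x.1 0))) x.1)})) → ∃ T : ℝ, ∀ i j : Fin N, i ≠ j → IntegrableOn (fun t : ℝ ↦ (‖ξ i t - ξ j t‖ ^ 2)⁻¹) (Set.Ioi T) := by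
  sorry

/-! ### Proved glue: the real analysis of the endgame (no `sorry`) -/

section Glue

/-- **Vector freezing lemma** (the `E3` version of the disprover's `tendsto_of_integrableOn_deriv`,
Disproof §D — "integrable force ⇒ frozen momentum: the mechanism"): a `C²` curve whose acceleration is
integrable on `(T, ∞)` has a limiting velocity, `deriv f → deriv f T + ∫_{(T,∞)} f''`. [folklore] -/
theorem tendsto_deriv_of_integrableOn_deriv2 {f : ℝ → E3} {T : ℝ} (hf : ContDiff ℝ 2 f)
    (hint : IntegrableOn (fun t ↦ deriv^[2] f t) (Ioi T)) :
    ∃ V : E3, Tendsto (deriv f) atTop (𝓝 V) := by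
  have hd1 : Differentiable ℝ (iteratedDeriv 1 f) :=
    hf.differentiable_iteratedDeriv 1 (by norm_num)
  have hc2 : Continuous (iteratedDeriv 2 f) := hf.continuous_iteratedDeriv 2 (by norm_num)
  have hderiv : ∀ t, HasDerivAt (deriv f) (deriv^[2] f t) t := fun t ↦ by
    have h := (hd1 t).hasDerivAt
    rw [iteratedDeriv_one] at h
    have e : deriv^[2] f = deriv (deriv f) := rfl
    rw [e]
    exact h
  have hcont : Continuous (deriv^[2] f) := by simpa [iteratedDeriv_eq_iterate] using hc2
  refine ⟨deriv f T + ∫ t in Ioi T, deriv^[2] f t, ?_⟩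
  have key : ∀ b, T ≤ b → deriv f b = deriv f T + ∫ t in T..b, deriv^[2] f t := by
    intro b hb
    rw [intervalIntegral.integral_eq_sub_of_hasDerivAt (fun x _ ↦ hderiv x)
      (hcont.intervalIntegrable _ _)]
    abel
  have h2 : Tendsto (fun b ↦ deriv f T + ∫ t in T..b, deriv^[2] f t) atTop
      (𝓝 (deriv f T + ∫ t in Ioi T, deriv^[2] f t)) :=
    (intervalIntegral_tendsto_integral_Ioi T hint tendsto_id).const_add _
  refine h2.congr' ?_
  filter_upwards [eventually_ge_atTop T] with b hb
  exact (key b hb).symm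

/-- **Cesàro from convergence**: if the velocity of a `C¹` curve converges to `V` then `t⁻¹ • f t → V`
(`f t − tV = (f T − TV) + ∫_T^t (f' − V)`, the integral `≤ ε(t − T)/2` eventually). [folklore] -/
theorem tendsto_inv_smul_of_tendsto_deriv {f : ℝ → E3} {V : E3} (hf : ContDiff ℝ 1 f)
    (h : Tendsto (deriv f) atTop (𝓝 V)) :
    Tendsto (fun t : ℝ ↦ t⁻¹ • f t) atTop (𝓝 V) := by
  have hd : Differentiable ℝ f := hf.differentiable one_ne_zero
  have hc : Continuous (deriv f) := hf.continuous_deriv le_rfl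
  rw [Metric.tendsto_atTop]
  intro ε hε
  obtain ⟨T₁, hT₁⟩ := Metric.tendsto_atTop.mp h (ε / 2) (half_pos hε)
  set T := max T₁ 1 with hTdef
  have hT1 : 1 ≤ T := le_max_right _ _
  have hT0 : 0 < T := by linarith
  set K := ‖f T - T • V‖ with hK
  have hK0 : 0 ≤ K := norm_nonneg _
  refine ⟨max T (2 * K / ε + 1), fun t ht ↦ ?_⟩
  have htT : T ≤ t := le_trans (le_max_left _ _) ht
  have ht0 : 0 < t := by linarith
  have hftc : ∫ s in T..t, deriv f s = f t - f T :=
    intervalIntegral.integral_eq_sub_of_hasDerivAt (fun x _ ↦ (hd x).hasDerivAt)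
      (hc.intervalIntegrable _ _)
  have hV : ∫ _ in T..t, V = (t - T) • V := by simp
  have hdecomp : t⁻¹ • f t - V = t⁻¹ • ((f T - T • V) + ∫ s in T..t, (deriv f s - V)) := by
    rw [intervalIntegral.integral_sub (hc.intervalIntegrable _ _) intervalIntegrable_const, hV, hftc]
    have : f T - T • V + (f t - f T - (t - T) • V) = f t - t • V := by
      rw [sub_smul]; abel
    rw [this, smul_sub, smul_smul, inv_mul_cancel₀ ht0.ne', one_smul]
  rw [dist_eq_norm, hdecomp, norm_smul, norm_inv, Real.norm_of_nonneg ht0.le]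
  have hint_bound : ‖∫ s in T..t, (deriv f s - V)‖ ≤ ε / 2 * |t - T| := by
    apply intervalIntegral.norm_integral_le_of_norm_le_const
    intro s hs
    rw [Set.uIoc_of_le htT] at hs
    have hs' : T₁ ≤ s := le_trans (le_max_left _ _) hs.1.le
    have := hT₁ s hs'
    rw [dist_eq_norm] at this
    exact this.le
  have hsum : ‖(f T - T • V) + ∫ s in T..t, (deriv f s - V)‖ ≤ K + ε / 2 * (t - T) := by
    refine (norm_add_le _ _).trans ?_
    rw [abs_of_nonneg (sub_nonneg.mpr htT)] at hint_bound
    exact add_le_add le_rfl hint_bound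
  have hKt : K < ε / 2 * t := by
    have h' : 2 * K / ε + 1 ≤ t := le_trans (le_max_right _ _) ht
    have h'' : 2 * K / ε * ε = 2 * K := div_mul_cancel₀ _ hε.ne'
    nlinarith [h', h'', hε]
  calc t⁻¹ * ‖(f T - T • V) + ∫ s in T..t, (deriv f s - V)‖
      ≤ t⁻¹ * (K + ε / 2 * (t - T)) :=
        mul_le_mul_of_nonneg_left hsum (inv_nonneg.mpr ht0.le)
    _ < t⁻¹ * (ε / 2 * t + ε / 2 * t) := by
        refine mul_lt_mul_of_pos_left ?_ (inv_pos.mpr ht0)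
        have : ε / 2 * (t - T) ≤ ε / 2 * t :=
          mul_le_mul_of_nonneg_left (by linarith) (half_pos hε).le
        linarith
    _ = ε := by field_simp; ring

/-- **Cesàro velocities pass between `o(1)`-close curves** (re-modulated ↔ painted centres). [folklore] -/
theorem tendsto_inv_smul_of_tendsto_norm_sub {f g : ℝ → E3} {V : E3}
    (hg : Tendsto (fun t : ℝ ↦ t⁻¹ • g t) atTop (𝓝 V))
    (hfg : Tendsto (fun t ↦ ‖g t - f t‖) atTop (𝓝 0)) :
    Tendsto (fun t : ℝ ↦ t⁻¹ • f t) atTop (𝓝 V) := by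
  have h0 : Tendsto (fun t : ℝ ↦ t⁻¹ • (g t - f t)) atTop (𝓝 0) := by
    have hgf : Tendsto (fun t ↦ g t - f t) atTop (𝓝 0) :=
      tendsto_zero_iff_norm_tendsto_zero.mpr hfg
    simpa using tendsto_inv_atTop_zero.smul hgf
  have heq : (fun t : ℝ ↦ t⁻¹ • f t) = fun t ↦ t⁻¹ • g t - t⁻¹ • (g t - f t) := by
    funext t; rw [smul_sub]; abel
  rw [heq]
  simpa using hg.sub h0

end Glue

/-! ### Composition -/

/-- **`InertialRecession` from the four stubs** (kernel-checked; no `sorry` of its own — it applies the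
registered stubs BY NAME and concludes the crux BY NAME, as the skeleton audit requires). Shape:
`stub_wallInflux → stub_energyPaidKicks`, `(stub_energyPaidKicks ∧ stub_newtonianBudget) ⇒` integrable
acceleration of each re-modulated centre `⇒` velocity limit (`tendsto_deriv_of_integrableOn_deriv2`) `⇒`
Cesàro velocity of the re-modulated centre (`tendsto_inv_smul_of_tendsto_deriv`) `⇒` of the painted centre
(`tendsto_inv_smul_of_tendsto_norm_sub`) `⇒ stub_cesaroRecharting ⇒ InertialRecession`. [folklore] -/
theorem InertialRecession_of :
    Summit.FinalStateConjecture.FinalStateConjecture.Theses.EIHFluxBalance.InertialRecession := by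
  -- the four registered stubs, used BY NAME (skeleton audit: no free hypotheses; sorries only in `stub_*`)
  have h1 := stub_cesaroRecharting
  have h2 := stub_energyPaidKicks
  have h3 := stub_wallInflux
  have h4 := stub_newtonianBudget
  intro X _ _ _ _ _ _ D hD 𝒟 h𝒟 hyp
  obtain ⟨N, M, a, rin, Λ, ξ, γ, κ, τ₀, U, Φ, O, hbig⟩ := hyp
  -- TRANSFER (stub 1): it suffices that every painted centre has a Cesàro velocity
  refine h1 X D hD 𝒟 h𝒟 N M a rin Λ ξ γ κ τ₀ U Φ O hbig fun i ↦ ?_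
  -- from here on `N ≥ 1` (there is a hole `i`); `N = 0` never reaches the engine
  have hN : 0 < N := Fin.pos i
  have hwall := h3 X D hD 𝒟 h𝒟 N M a rin Λ ξ γ κ τ₀ U Φ O hbig hN
  obtain ⟨T₂, C, ξ₁, η, hC2, hclose, hη, hlaw⟩ :=
    h2 X D hD 𝒟 h𝒟 N M a rin Λ ξ γ κ τ₀ U Φ O hbig hwall
  obtain ⟨T₄, hNB⟩ := h4 X D hD 𝒟 h𝒟 N M a rin Λ ξ γ κ τ₀ U Φ O hbig
  -- Cesàro velocity of the painted centre `ξ i`: the acceleration of the re-modulated centre `ξ₁ i`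
  -- is dominated on `(T, ∞)`, `T := max T₂ T₄`, by `C · Σ_{j ≠ i} s_ij⁻²` (integrable: Newtonian budget)
  -- plus `η i` (integrable: energy-paid kicks), hence integrable; so `deriv (ξ₁ i)` converges
  -- (vector freezing lemma), so `t⁻¹ • ξ₁ i t` converges (Cesàro), so `t⁻¹ • ξ i t` does (closeness).
  set T := max T₂ T₄ with hTdef
  have hmaj : IntegrableOn
      (fun t ↦ C * (∑ j ∈ Finset.univ.erase i, (‖ξ i t - ξ j t‖ ^ 2)⁻¹) + η i t) (Ioi T) := by
    refine IntegrableOn.add ?_ ((hη i).mono_set (Ioi_subset_Ioi (le_max_left _ _)))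
    refine Integrable.const_mul ?_ C
    refine integrable_finsetSum _ fun j hj ↦ ?_
    exact (hNB i j (Finset.ne_of_mem_erase hj).symm).mono_set (Ioi_subset_Ioi (le_max_right _ _))
  have hcont : Continuous (deriv^[2] (ξ₁ i)) := by
    simpa [iteratedDeriv_eq_iterate] using (hC2 i).continuous_iteratedDeriv 2 (by norm_num)
  have hacc : IntegrableOn (fun t ↦ deriv^[2] (ξ₁ i) t) (Ioi T) := by
    refine Integrable.mono' hmaj hcont.aestronglyMeasurable ?_
    rw [ae_restrict_iff' measurableSet_Ioi]
    exact Eventually.of_forall fun t ht ↦ hlaw i t (le_trans (le_max_left _ _) (le_of_lt ht))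
  obtain ⟨V, hV⟩ := tendsto_deriv_of_integrableOn_deriv2 (hC2 i) hacc
  exact ⟨V, tendsto_inv_smul_of_tendsto_norm_sub
    (tendsto_inv_smul_of_tendsto_deriv ((hC2 i).of_le (by norm_num)) hV) (hclose i)⟩

/-- Wiring check: the registered stubs feed `InertialRecession_of` as stated (the route decl, by name). -/
example : Summit.FinalStateConjecture.FinalStateConjecture.Theses.EIHFluxBalance.InertialRecession :=
  InertialRecession_of

end Summit.FinalStateConjecture.FinalStateConjecture.Cruxes.InertialRecession.MomentumVariationIsPaidInEnergy

end
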